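import Mathlib
import Literature.Analysis.FluidPDE.NSLocalAnalyticityRadiusProofs
import Literature.Analysis.FluidPDE.NSLocalAnalyticityRadiusTube
import Literature.Analysis.FluidPDE.SteadyStrainedNS
import Literature.Analysis.FunctionSpaces.TorusTrigPoly
import HarnessLib

/-!
# SteadyNSRealAnalytic

Topic `Literature/Uncategorized`. Named literature fact(s) relocated by the gate from `Summits/AnomalousDissipation/AnomalousDissipation/Theorems/DyadicRealisation/Negative/WallProfileExistsFalseOfSteadyNSRealAnalytic.lean`
(accept-time relocation of `[cite]`d propositions written inline in a Summits proposal; human ruling 2026-08-15).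
Sources: Morrey1958.

* `Literature.Uncategorized.SteadyNSRealAnalytic`

## Discharge (2026-08-17)

`SteadyNSRealAnalytic_holds : SteadyNSRealAnalytic` is PROVED below, not through Morrey's
elliptic theory but through the tree's proof of the Bradshaw–Grujić–Kukavica local analyticity
radius theorem (`Literature.Analysis.FluidPDE.bradshawGrujicKukavica2015_local_analyticity_radius_holds`,
J. Differential Equations 259 (2015), Thm. 2.3 = LMS Lecture Notes 430 (2016), Thm. 2.3.1): a
smooth steady pair `(W, P)` is a locally smooth solution of the time-dependent system on every
`(0, 1) × 4B_*`, its local `L⁶`/`L³`/`L⁵_t L⁶_x` quantities are finite by continuity on the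
compact closed ball, so each slice — i.e. `W` itself — agrees on `B_*` with a map holomorphic on
the local complex region `Ω_*(t)`; Osgood's lemma (`Literature.Analysis.Complex.SCV.analyticAt_of_differentiableOn`)
and `W = Re ∘ U ∘ complexify` on the ball give real-analyticity at the centre. The bounded case
has a second, independent proof in `Literature/Analysis/FluidPDE/SteadyNSBoundedAnalytic.lean`
(Oseen-mild route, Lemarié-Rieusset 2016 Thm. 9.12).
-/

namespace Literature.Uncategorized

open scoped BigOperators Topology
open Filter Set MeasureTheory

/-- **H — real-analyticity of smooth entire steady Navier–Stokes flows** (classical; NOT yet a tree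
fact, whence this file is a negative lemma MODULO H).  Every `C^∞` solution `(W, P)` on all of `ℝ³` of
the stationary incompressible Navier–Stokes system at unit viscosity without force — `div W = 0` and
`(W·∇)W + ∇P = ΔW`, written clause-for-clause as in
`Summit.AnomalousDissipation.AnomalousDissipation.Theses.DyadicWallCascade.WallProfileExists`
(`∑ᵢ (DW(X) eᵢ)ᵢ = 0`, `DW(X)(W X) + ∇P(X) = ∑ᵢ D(DW(·) eᵢ)(X) eᵢ`) — has a real-analytic velocity
field (`AnalyticOnNhd ℝ W univ`: locally the sum of its Taylor series).  Printed source: Morrey's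
analyticity theorem for solutions of analytic non-linear elliptic systems, the stationary
Navier–Stokes system `(W, P) ↦ (ΔW - (W·∇)W - ∇P, div W)` being elliptic in the sense of
Agmon–Douglis–Nirenberg with polynomial non-linearity; for Navier–Stokes specifically Kahane 1969
(spatial analyticity of weak solutions with analytic force, interior statement).
[cite: Morrey1958, Amer. J. Math. 80 (1958) 198–218 (Part I, analyticity in the interior), main
theorem; Kahane1969, Arch. Rational Mech. Anal. 33 (1969) 386–405, Thm. (spatial analyticity)]
[topic: Literature/Analysis/FluidPDE — regularity of steady Navier–Stokes solutions
(cf. `SteadyNavierStokesRegularity.lean`, Temam 1979 Prop. II.1.1 on `T^d`)] -/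
def SteadyNSRealAnalytic : Prop :=
  ∀ (W : EuclideanSpace ℝ (Fin 3) → EuclideanSpace ℝ (Fin 3)) (P : EuclideanSpace ℝ (Fin 3) → ℝ),
    ContDiff ℝ ((⊤ : ℕ∞) : WithTop ℕ∞) W → ContDiff ℝ ((⊤ : ℕ∞) : WithTop ℕ∞) P →
    (∀ X, ∑ i : Fin 3, (fderiv ℝ W X (EuclideanSpace.single i (1 : ℝ))) i = 0) →
    (∀ X, (fderiv ℝ W X) (W X) + gradient P X =
      ∑ i : Fin 3, fderiv ℝ (fun Y => fderiv ℝ W Y (EuclideanSpace.single i (1 : ℝ))) X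
        (EuclideanSpace.single i (1 : ℝ))) →
    AnalyticOnNhd ℝ W Set.univ

/-! ### Discharge of the fact -/

section Discharge

open Metric Function
open scoped ContDiff Laplacian InnerProductSpace ENNReal
open Literature.Analysis.FluidPDE
open Literature.Analysis.FunctionSpaces.EuclideanSpace (complexify realPart realPart_complexify)

/-- **The coordinate clauses are the steady classical Navier–Stokes system**: `C^∞` fields
`W`, `P` on `ℝ³` with `∑ᵢ (DW(X) eᵢ)ᵢ = 0` and `DW(X)(W X) + ∇P(X) = ∑ᵢ D(DW(·) eᵢ)(X) eᵢ`
(`eᵢ = EuclideanSpace.single i 1`) form a steady classical solution of the unforced system at unit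
viscosity, `IsSteadyClassicalNS 1 0 W P` (`SteadyStrainedNS.lean`): the sums are the divergence
(`divergence_eq_sum_inner_fderiv`) and the Laplacian (`laplacian_eq_sum_fderiv_fderiv`) in the
standard frame. [folklore] -/
theorem isSteadyClassicalNS_of_clauses
    {W : EuclideanSpace ℝ (Fin 3) → EuclideanSpace ℝ (Fin 3)} {P : EuclideanSpace ℝ (Fin 3) → ℝ}
    (hW : ContDiff ℝ ((⊤ : ℕ∞) : WithTop ℕ∞) W) (hP : ContDiff ℝ ((⊤ : ℕ∞) : WithTop ℕ∞) P)
    (hdiv : ∀ X, ∑ i : Fin 3, (fderiv ℝ W X (EuclideanSpace.single i (1 : ℝ))) i = 0)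
    (hNS : ∀ X, (fderiv ℝ W X) (W X) + gradient P X =
      ∑ i : Fin 3, fderiv ℝ (fun Y => fderiv ℝ W Y (EuclideanSpace.single i (1 : ℝ))) X
        (EuclideanSpace.single i (1 : ℝ))) :
    IsSteadyClassicalNS 1 0 W P := by
  have hW2 : ContDiff ℝ 2 W := contDiff_infty.1 hW 2
  have hlap : ∀ X, (Δ W) X =
      ∑ i : Fin 3, fderiv ℝ (fun Y => fderiv ℝ W Y (EuclideanSpace.single i (1 : ℝ))) X
        (EuclideanSpace.single i (1 : ℝ)) := by
    intro X
    rw [laplacian_eq_sum_fderiv_fderiv (EuclideanSpace.basisFun (Fin 3) ℝ) hW2 X]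
    simp only [EuclideanSpace.basisFun_apply]
  exact
    { smooth_velocity := hW
      smooth_pressure := hP
      momentum := fun X => by
        rw [convect_apply, one_smul, Pi.zero_apply, add_zero, hlap X, ← hNS X, add_sub_cancel_right]
      divFree := fun X => by
        rw [divergence_eq_sum_inner_fderiv (EuclideanSpace.basisFun (Fin 3) ℝ) W X]
        simpa only [EuclideanSpace.basisFun_apply, EuclideanSpace.inner_single_left, map_one,
          one_mul] using hdiv X }

/-- A continuous field has finite `L^p` norm on every ball of `ℝ³` (it is bounded on the compact
closed ball, and the ball has finite measure). [folklore] -/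
theorem eLpNorm_restrict_ball_lt_top_of_continuous {F : Type*} [NormedAddCommGroup F]
    {g : EuclideanSpace ℝ (Fin 3) → F} (hg : Continuous g) (x₀ : EuclideanSpace ℝ (Fin 3)) (R : ℝ)
    (p : ℝ≥0∞) :
    eLpNorm g p ((volume : Measure (EuclideanSpace ℝ (Fin 3))).restrict (ball x₀ R)) < ⊤ := by
  haveI : IsFiniteMeasure ((volume : Measure (EuclideanSpace ℝ (Fin 3))).restrict (ball x₀ R)) :=
    isFiniteMeasure_restrict.2 measure_ball_lt_top.ne
  obtain ⟨K, hK⟩ := (isCompact_closedBall x₀ R).exists_bound_of_continuousOn hg.continuousOn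
  have hae : ∀ᵐ x ∂((volume : Measure (EuclideanSpace ℝ (Fin 3))).restrict (ball x₀ R)),
      ‖g x‖ ≤ K := by
    rw [ae_restrict_iff' measurableSet_ball]
    exact Eventually.of_forall fun x hx => hK x (ball_subset_closedBall hx)
  exact ((memLp_top_of_bound hg.aestronglyMeasurable K hae).mono_exponent le_top).eLpNorm_lt_top

/-- **H holds: smooth entire steady Navier–Stokes flows are real-analytic** — discharge of
`SteadyNSRealAnalytic`. Proof: the constant-in-time pair is a classical solution of the
time-dependent system on `ℝ × ℝ³` (`isSteadyClassicalNS_of_clauses`,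
`isSteadyClassicalNS_iff_const`); about any centre `x₀` its local quantities on `(0,1) × 4B_*`,
`B_* = B(x₀, 1)`, with `q = 6`, `r = 5`, are finite (continuity on the closed ball), so by the
PROVED Bradshaw–Grujić–Kukavica local analyticity radius theorem
(`bradshawGrujicKukavica2015_local_analyticity_radius_holds`, through
`….of_isClassicalNSSolutionOn`) the slice `W` agrees on `B_*` with a map `U` holomorphic on the
open local region `Ω_*(t)`, `t = T₁/2`; `U` is analytic there (Osgood,
`SCV.analyticAt_of_differentiableOn`), hence real-analytic, and `W = Re ∘ U ∘ complexify` near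
`x₀` (`realPart_complexify`). [cite: BradshawGrujicKukavica2015, Thm. 2.3 (pp. 4–5) and §4] -/
theorem SteadyNSRealAnalytic_holds : SteadyNSRealAnalytic := by
  classical
  intro W P hW hP hdiv hNS x₀ _
  -- the constant-in-time classical solution on `ℝ × ℝ³`
  have hcl : IsClassicalNSSolutionOn (univ : Set ℝ) 1 0 (fun _ : ℝ => W) (fun _ : ℝ => P) :=
    isSteadyClassicalNS_iff_const.1 (isSteadyClassicalNS_of_clauses hW hP hdiv hNS)
  obtain ⟨C₀, C, hC₀, hC, hfact⟩ :=
    bradshawGrujicKukavica2015_local_analyticity_radius.of_isClassicalNSSolutionOn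
      bradshawGrujicKukavica2015_local_analyticity_radius_holds
  -- the local quantities on `4B_*` (`q = 6`, `r = 5`)
  set μ : Measure (EuclideanSpace ℝ (Fin 3)) :=
    (volume : Measure (EuclideanSpace ℝ (Fin 3))).restrict (ball x₀ (4 * 1)) with hμ
  have hXA : eLpNorm W (ENNReal.ofReal 6) μ < ⊤ :=
    eLpNorm_restrict_ball_lt_top_of_continuous hW.continuous x₀ _ _
  have hXB : eLpNorm P (ENNReal.ofReal (6 / 2)) μ < ⊤ :=
    eLpNorm_restrict_ball_lt_top_of_continuous hP.continuous x₀ _ _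
  have hGc : Continuous fun x => Real.sqrt (frobeniusNormSq (fderiv ℝ W x)) := by
    refine Real.continuous_sqrt.comp ?_
    unfold frobeniusNormSq
    refine continuous_finsetSum _ fun i _ => ?_
    exact ((((contDiff_infty.1 hW 1).continuous_fderiv one_ne_zero).clm_apply
      continuous_const).norm).pow 2
  have hXD : eLpNorm (fun x => Real.sqrt (frobeniusNormSq (fderiv ℝ W x))) (ENNReal.ofReal 6) μ < ⊤ :=
    eLpNorm_restrict_ball_lt_top_of_continuous hGc x₀ _ _
  set A : ℝ := (eLpNorm W (ENNReal.ofReal 6) μ).toReal + 1 with hA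
  set B : ℝ := Real.sqrt (eLpNorm P (ENNReal.ofReal (6 / 2)) μ).toReal with hB
  set D : ℝ := (eLpNorm (fun x => Real.sqrt (frobeniusNormSq (fderiv ℝ W x)))
    (ENNReal.ofReal 6) μ).toReal with hD
  have hA0 : 0 < A := by rw [hA]; positivity
  have hB0 : 0 ≤ B := Real.sqrt_nonneg _
  have hD0 : 0 ≤ D := ENNReal.toReal_nonneg
  have hAbd : ∀ t ∈ Ioo (0 : ℝ) 1,
      eLpNorm ((fun _ : ℝ => W) t) (ENNReal.ofReal 6) μ ≤ ENNReal.ofReal A := by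
    intro t _
    calc eLpNorm W (ENNReal.ofReal 6) μ
        = ENNReal.ofReal (eLpNorm W (ENNReal.ofReal 6) μ).toReal := (ENNReal.ofReal_toReal hXA.ne).symm
      _ ≤ ENNReal.ofReal A := ENNReal.ofReal_le_ofReal (by rw [hA]; linarith)
  have hBbd : ∀ t ∈ Ioo (0 : ℝ) 1,
      eLpNorm ((fun _ : ℝ => P) t) (ENNReal.ofReal (6 / 2)) μ ≤ ENNReal.ofReal (B ^ 2) := by
    intro t _
    rw [hB, Real.sq_sqrt ENNReal.toReal_nonneg, ENNReal.ofReal_toReal hXB.ne]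
  have hDbd : ∫⁻ t in Ioo (0 : ℝ) 1, eLpNorm (fun x => Real.sqrt (frobeniusNormSq
      (fderiv ℝ ((fun _ : ℝ => W) t) x))) (ENNReal.ofReal 6) μ ^ (5 : ℝ) ≤
        ENNReal.ofReal (D ^ (5 : ℝ)) := by
    show ∫⁻ _ in Ioo (0 : ℝ) 1, eLpNorm (fun x => Real.sqrt (frobeniusNormSq (fderiv ℝ W x)))
      (ENNReal.ofReal 6) μ ^ (5 : ℝ) ≤ _
    rw [setLIntegral_const, Real.volume_Ioo, sub_zero, ENNReal.ofReal_one, mul_one, hD,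
      ← ENNReal.ofReal_rpow_of_nonneg ENNReal.toReal_nonneg (by norm_num : (0 : ℝ) ≤ 5),
      ENNReal.ofReal_toReal hXD.ne]
  -- the fact, about `x₀` with `r_* = 1`, `T₀ = 1`, `q = 6`, `r = 5`
  have key := hfact x₀ (one_pos : (0 : ℝ) < 1) (one_pos : (0 : ℝ) < 1) (by norm_num : (3 : ℝ) < 6)
    (by norm_num : 2 * 6 / (6 - 3) < (5 : ℝ)) (subset_univ _) hcl hA0.le hB0 hD0 hAbd hBbd hDbd
  set T₁ : ℝ := C⁻¹ * min (min 1 ((1 : ℝ) ^ 2))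
    ((6 : ℝ) ^ 2 * (C * (A + B + (1 : ℝ) ^ ((5 - 2) / (2 * 5) : ℝ) * D)) ^ (2 * 6 / (6 - 3) : ℝ))⁻¹
    with hT₁
  have hT₁0 : 0 < T₁ := by rw [hT₁]; positivity
  obtain ⟨U, hU, hUeq⟩ := key (T₁ / 2) ⟨half_pos hT₁0, half_lt_self hT₁0⟩
  -- real-analyticity at `x₀` from the holomorphic extension
  set h : ℝ := Real.sqrt (T₁ / 2) / (4 * C₀) with hh
  have hh0 : 0 < h := by rw [hh]; positivity
  have hx₀ : complexify x₀ ∈ localComplexTube x₀ 1 h :=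
    complexify_mem_localComplexTube hh0 (by simp)
  have hUan : AnalyticAt ℂ U (complexify x₀) :=
    Literature.Analysis.Complex.SCV.analyticAt_of_differentiableOn hU
      (isOpen_localComplexTube x₀ 1 h) hx₀
  have hcomp : AnalyticAt ℝ (fun x => realPart (U (complexify x))) x₀ :=
    ((realPart (ι := Fin 3)).analyticAt _).comp
      ((hUan.restrictScalars (𝕜 := ℝ)).comp (complexify.toContinuousLinearMap.analyticAt x₀))
  have hev : (fun x => realPart (U (complexify x))) =ᶠ[𝓝 x₀] W := by
    filter_upwards [isOpen_ball.mem_nhds (mem_ball_self (zero_lt_one : (0 : ℝ) < 1))] with x hx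
    rw [hUeq x hx, realPart_complexify]
  exact hcomp.congr hev

end Discharge

end Literature.Uncategorized
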